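import Literature.NumberTheory.Weil1964.ThetaDistribution
import Mathlib.Topology.Algebra.Group.Quotient
import Mathlib.Topology.ContinuousMap.Basic
import Mathlib.Topology.CompactOpen
import Mathlib.Topology.Maps.OpenQuotient
import HarnessLib

/-!
# Theta kernels on a pair of quotients from Weil's theta distribution and a dual-pair splitting
(Weil, *Sur certains groupes d'opérateurs unitaires* (1964), Chap. III n° 37–41; Fleig–Gustafsson–
Kleinschmidt–Persson, *Eisenstein Series and Automorphic Representations* (2018), §12.3 (12.37)–(12.38))

Topic `NumberTheory/Weil1964`; namespace `Literature.NumberTheory.Weil1964`.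

INPUT (a hypothesis structure `ThetaKernelDatum`, nothing asserted): a Weil theta datum
`W : WeilThetaDatum Mp SX` (this directory's `ThetaDistribution`: carriers `Mp = Mp(X)_A`, `SX = S(X_A)`,
the action `(S, Φ) ↦ SΦ`, the rational lift `rat = r_k(Ps(X)_k)`, the theta distribution
`theta Φ S = Θ_Φ(S) = Σ_{ξ ∈ X_k} (SΦ)(ξ)` [Weil1964, n° 41]) together with
* `act_one` — the unit of `Mp(X)_A` acts trivially; `theta_act` — `Θ_{S'Φ}(S) = Θ_Φ(S S')` (Weil's
  DEFINITION of `Θ`, n° 41 p. 193, combined with `S(S'Φ) = (SS')Φ`, n° 37);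
* the two PRINT statements BY NAME, as hypotheses: `W.ActionContinuous` [n° 39, p. 189] and
  `W.ThetaContinuousInvariant` [n° 41 Théorème 6, p. 193];
* `dist_cont` — continuity of the theta distribution `Φ ↦ Θ_Φ(1)` on `S(X_A)` (print-derived: proof of
  Théorème 6, p. 194, termwise continuity + Lemme 5);
* a DUAL-PAIR SPLITTING `s : GU × G →* Mp(X)_A`, continuous, carrying `ΓU × Γ` into `rat` (for a dual
  reductive pair `(H, H')` inside `Sp(𝕎)`, a homomorphic lift `H(𝔸) × H'(𝔸) → Mp(𝕎)_A` taking rational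
  points to `r_k(Sp(𝕎)_k)`; Kudla 1994, Harris–Kudla–Sweet 1996 §1 for unitary dual pairs);
* an index set `SK ⊆ S(X_A)` stable under `s(1 × G)`.

OUTPUT (constructed and proved):
* `omg h Φ := s(1, h)·Φ` on `SK` (§2), with `omg_one : ω(1)Φ = Φ`;
* the kernel upstairs `thetaFun Φ (x, y) := Θ_Φ(s(x, y)⁻¹)` on `GU × G` (§3): continuous in `(x, y)`
  (Théorème 6, conjunct 1, along `s`), jointly continuous in `(Φ, x, y)` (n° 39 + `dist_cont`), and
  right-`ΓU × Γ`-invariant (Théorème 6, conjunct 2, and `s(ΓU × Γ) ⊆ rat`);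
* its DESCENT `θ Φ ∈ C((GU ⧸ ΓU) × (G ⧸ Γ), ℂ)` (§4) — the theta kernel `θ(h, h')` of the dual pair as a
  continuous function on the product of the two quotients [FleigEtAl2018, §12.3 (12.37)–(12.38): "the
  function … is by construction invariant under `H'(F)` (resp. `H(F)`)"];
* the three STRUCTURAL LAWS (§5): `omg_one`; `θ_cont : Continuous θ` for the compact-open topology;
  `θ_omg : θ_{ω(h)Φ}(ξ, q) = θ_Φ(ξ, h⁻¹ • q)`; and two by-products (§6): `θ_omg_curry`,
  `continuous_θ_omg_uncurry` (joint continuity of `(h, ξ, q) ↦ θ_{ω(h)Φ}(ξ, q)`).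

CONVENTION. Mathlib's `G ⧸ Γ` is the space of LEFT cosets `gΓ`: functions on it are the RIGHT-`Γ`-invariant
functions on `G`, and `G` acts on the left. Weil's Théorème 6 gives LEFT invariance of `Θ` under rational
elements; the dictionary `g ↦ g⁻¹` (the kernel upstairs is evaluated at `s(x, y)⁻¹`) turns it into right
invariance, and the classical translation law `θ_Φ(g, yh) = θ_{ω(h)Φ}(g, y)` into `θ_omg` above.

## Mathlib / tree

Mathlib: `QuotientGroup.mk`, `QuotientGroup.isOpenQuotientMap_mk`, `IsOpenQuotientMap.prodMap`,
`ContinuousMap.continuous_of_continuous_uncurry`, `MulAction.Quotient.smul_mk`. Tree: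
`Weil1964.ThetaDistribution` (`WeilThetaDatum`, `ActionContinuous`, `ThetaContinuousInvariant` and its two
corollaries). No Mathlib or tree declaration is duplicated; NOT here: any construction of `Mp(X)_A`,
`S(X_A)`, `r_k` or of a splitting (the carriers stay parameters, as in `ThetaDistribution`).

## Design notes

* `ThetaKernelDatum` extends nothing and asserts nothing: every print statement it uses is a FIELD
  (hypothesis), typed exactly as in `ThetaDistribution`; consumers supply an instance.
* `descend` is a two-line `Quotient.lift` for right-invariant functions (Mathlib's `QuotientGroup.lift` is
  for homomorphisms); the continuity downstairs goes through the open quotient map `id × mk × mk`.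
* Provenance. Written under the LEAN-IN-TREE rule (2026-08-18) for the pub-hodgecm formalisation cell
  (prl1 lineage): it is the cell package's `HodgeCM/Automorphic/WeilThetaModel.lean` §§1–6 re-based on the
  tree's `WeilThetaDatum Mp SX` (the package bundled the carriers into the datum). Nothing in this file is
  a claim of the manuscripts adjudicated by that cell.

## References

* A. Weil, *Sur certains groupes d'opérateurs unitaires*, Acta Math. 111 (1964) 143–211: n° 37–41,
  pp. 187–194 (n° 39 p. 189; n° 41 Théorème 6 p. 193, proof p. 194) [Weil1964].
* P. Fleig, H. P. A. Gustafsson, A. Kleinschmidt, D. Persson, *Eisenstein Series and Automorphic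
  Representations*, CUP (2018), §12.3, Definitions 12.4–12.5, (12.37)–(12.38) (held text, PDF pp. 275–276)
  [FleigEtAl2018].
* S. Kudla, *Splitting metaplectic covers of dual reductive pairs*, Israel J. Math. 87 (1994) [Kudla1994].
* M. Harris, S. Kudla, W. J. Sweet, *Theta dichotomy for unitary groups*, J. AMS 9 (1996), §1
  [HarrisKudlaSweet1996].
-/

set_option autoImplicit false

noncomputable section

open Topology

namespace Literature.NumberTheory.Weil1964

universe u v

/-! ## 1. The datum -/

/-- **Theta-kernel datum** for a pair of quotients `GU ⧸ ΓU` and `G ⧸ Γ`: a Weil theta datum `W` on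
carriers `Mp = Mp(X)_A`, `SX = S(X_A)` with the unit law of its action, Weil's definition of `Θ` as
"distribution after action", the two PRINT facts n° 39 / Théorème 6 BY NAME (hypotheses), the continuity
of the theta distribution, a dual-pair splitting `s : GU × G →* Mp(X)_A` (continuous, rational points to
`r_k(Ps(X)_k)`), and an index set `SK ⊆ S(X_A)` stable under `s(1 × G)`. A hypothesis structure: nothing
is asserted. [cite: Weil1964, Chap. III n° 37–41, pp. 187–194] -/
structure ThetaKernelDatum (Mp : Type u) (SX : Type v) [TopologicalSpace Mp] [Group Mp]
    [TopologicalSpace SX] (GU : Type*) [Group GU] [TopologicalSpace GU] (ΓU : Subgroup GU)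
    (G : Type*) [Group G] [TopologicalSpace G] (Γ : Subgroup G) where
  /-- the carriers of [Weil1964, n° 37–41]: `act`, `rat = r_k(Ps(X)_k)`, `theta` -/
  W : WeilThetaDatum Mp SX
  /-- the unit of `Mp(X)_A` acts trivially on `S(X_A)` -/
  act_one : ∀ Φ : SX, W.act 1 Φ = Φ
  /-- `Θ_{S'Φ}(S) = Θ_Φ(S S')` [n° 41 p. 193: `Θ(S) = Σ_{ξ ∈ X_k} (SΦ)(ξ)`, with `S(S'Φ) = (SS')Φ`, n° 37] -/
  theta_act : ∀ (Φ : SX) (S S' : Mp), W.theta (W.act S' Φ) S = W.theta Φ (S * S')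
  /-- PRINT BY NAME [Weil1964, n° 39, p. 189]: `(S, Φ) ↦ SΦ` is jointly continuous -/
  actionContinuous : W.ActionContinuous
  /-- PRINT BY NAME [Weil1964, n° 41 Théorème 6, p. 193]: `S ↦ Θ_Φ(S)` continuous and
  left-`r_k(Ps(X)_k)`-invariant -/
  thetaContinuousInvariant : W.ThetaContinuousInvariant
  /-- PRINT-DERIVED [Weil1964, p. 194]: the theta distribution `Φ ↦ Θ_Φ(1)` is continuous -/
  dist_cont : Continuous fun Φ : SX => W.theta Φ 1
  /-- the dual-pair splitting `GU × G → Mp(X)_A`, a homomorphism … -/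
  s : GU × G →* Mp
  /-- … continuous … -/
  s_cont : Continuous s
  /-- … carrying `ΓU × Γ` into the rational lift `r_k(Ps(X)_k)` -/
  s_rat : ∀ γU ∈ ΓU, ∀ γ ∈ Γ, s (γU, γ) ∈ W.rat
  /-- the index set `SK ⊆ S(X_A)` … -/
  SK : Set SX
  /-- … stable under `s(1, h)`, `h ∈ G` -/
  SK_stable : ∀ (h : G) (Φ : SX), Φ ∈ SK → W.act (s (1, h)) Φ ∈ SK

namespace ThetaKernelDatum

variable {Mp : Type u} {SX : Type v} [TopologicalSpace Mp] [Group Mp] [TopologicalSpace SX]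
variable {GU : Type*} [Group GU] [TopologicalSpace GU] {ΓU : Subgroup GU}
variable {G : Type*} [Group G] [TopologicalSpace G] {Γ : Subgroup G}
variable (M : ThetaKernelDatum Mp SX GU ΓU G Γ)

/-! ## 2. The action `ω(h)` on the index set -/

/-- **`ω(h)Φ := s(1, h)·Φ`** on the index set `SK`. [folklore] -/
def omg (h : G) (Φ : M.SK) : M.SK :=
  ⟨M.W.act (M.s (1, h)) Φ.1, M.SK_stable h Φ.1 Φ.2⟩

/-- `ω(h)Φ` on underlying elements. [folklore] -/
@[simp] theorem coe_omg (h : G) (Φ : M.SK) : (M.omg h Φ : SX) = M.W.act (M.s (1, h)) Φ.1 := rfl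

/-- **Structural law 1**: `ω(1)Φ = Φ` — from `s(1) = 1` and the unit law of the action. [folklore] -/
theorem omg_one (Φ : M.SK) : M.omg 1 Φ = Φ := by
  apply Subtype.ext
  have h1 : ((1 : GU), (1 : G)) = (1 : GU × G) := rfl
  simp only [coe_omg, h1, map_one, M.act_one]

/-- `Θ_{ω(hh')Φ}(S) = Θ_{ω(h')Φ}(S · s(1, h))`. [folklore] -/
theorem theta_omg_mul (h h' : G) (Φ : M.SK) (S : Mp) :
    M.W.theta (M.omg (h * h') Φ : SX) S = M.W.theta (M.omg h' Φ : SX) (S * M.s (1, h)) := by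
  have hp : ((1 : GU), h * h') = ((1 : GU), h) * ((1 : GU), h') := by simp
  simp only [coe_omg, M.theta_act, hp, map_mul, mul_assoc]

/-! ## 3. The kernel upstairs: `(x, y) ↦ Θ_Φ(s(x, y)⁻¹)` on `GU × G` -/

/-- The theta kernel pulled back to `GU × G` in Mathlib's coset convention:
`thetaFun Φ (x, y) = Θ_Φ(s(x, y)⁻¹)`. [cite: FleigEtAl2018, §12.3 (12.37)–(12.38) (the kernel θ(h, h'))] -/
def thetaFun (Φ : SX) (p : GU × G) : ℂ :=
  M.W.theta Φ (M.s p⁻¹)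

/-- Unfolding `thetaFun`. [folklore] -/
theorem thetaFun_apply (Φ : SX) (p : GU × G) : M.thetaFun Φ p = M.W.theta Φ (M.s p⁻¹) := rfl

/-- `Θ_Φ(s(p)⁻¹) = Θ_{s(p)⁻¹Φ}(1)`: the kernel is the theta DISTRIBUTION of the translated function.
[folklore] -/
theorem thetaFun_eq_dist (Φ : SX) (p : GU × G) :
    M.thetaFun Φ p = M.W.theta (M.W.act (M.s p⁻¹) Φ) 1 := by
  rw [thetaFun, M.theta_act, one_mul]

/-- Continuity of the kernel in the group variables (Théorème 6, conjunct 1, along the continuous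
splitting). [cite: Weil1964, Chap. III n° 41 Théorème 6, p. 193] -/
theorem continuous_thetaFun [ContinuousInv GU] [ContinuousInv G] (Φ : SX) :
    Continuous (M.thetaFun Φ) :=
  M.thetaContinuousInvariant.theta_comp_continuous Φ (M.s_cont.comp continuous_inv)

/-- **Joint continuity** of `(Φ, x, y) ↦ Θ_Φ(s(x, y)⁻¹)` on `S(X_A) × (GU × G)`: n° 39 (joint continuity
of the action) composed with the continuity of the theta distribution.
[cite: Weil1964, Chap. III n° 39, p. 189] -/
theorem continuous_thetaFun_uncurry [ContinuousInv GU] [ContinuousInv G] :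
    Continuous fun q : SX × (GU × G) => M.thetaFun q.1 q.2 := by
  have hact : Continuous fun q : SX × (GU × G) => M.W.act (M.s q.2⁻¹) q.1 := by
    have h := M.actionContinuous
    unfold WeilThetaDatum.ActionContinuous at h
    exact h.comp (((M.s_cont.comp continuous_inv).comp continuous_snd).prodMk continuous_fst)
  simpa only [thetaFun_eq_dist, Function.comp_def] using M.dist_cont.comp hact

/-- **Right `ΓU × Γ`-invariance** of the kernel upstairs (Théorème 6, conjunct 2, and
`s(ΓU × Γ) ⊆ r_k(Ps(X)_k)`). [cite: Weil1964, Chap. III n° 41 Théorème 6, p. 193] -/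
theorem thetaFun_mul_right (Φ : SX) (p : GU × G) {γU : GU} (hγU : γU ∈ ΓU) {γ : G} (hγ : γ ∈ Γ) :
    M.thetaFun Φ (p * (γU, γ)) = M.thetaFun Φ p := by
  have hrat : M.s (γU, γ)⁻¹ ∈ M.W.rat := by
    rw [Prod.inv_mk]
    exact M.s_rat γU⁻¹ (inv_mem hγU) γ⁻¹ (inv_mem hγ)
  simp only [thetaFun, mul_inv_rev, map_mul]
  exact M.thetaContinuousInvariant.theta_left_invariant Φ hrat _

/-- Right `ΓU`-invariance in the first variable. [folklore] -/
theorem thetaFun_mul_right_U (Φ : SX) (x : GU) (y : G) {γU : GU} (hγU : γU ∈ ΓU) :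
    M.thetaFun Φ (x * γU, y) = M.thetaFun Φ (x, y) := by
  simpa using M.thetaFun_mul_right Φ (x, y) hγU (one_mem Γ)

/-- Right `Γ`-invariance in the second variable. [folklore] -/
theorem thetaFun_mul_right_W (Φ : SX) (x : GU) (y : G) {γ : G} (hγ : γ ∈ Γ) :
    M.thetaFun Φ (x, y * γ) = M.thetaFun Φ (x, y) := by
  simpa using M.thetaFun_mul_right Φ (x, y) (one_mem ΓU) hγ

end ThetaKernelDatum

/-! ## 4. Descent to `(GU ⧸ ΓU) × (G ⧸ Γ)` -/

section Descend

variable {H : Type*} [Group H] (Δ : Subgroup H) {Z : Type*}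

/-- Descend a right-`Δ`-invariant function on `H` to Mathlib's coset space `H ⧸ Δ`. [folklore] -/
def descend (f : H → Z) (hf : ∀ (g : H), ∀ γ ∈ Δ, f (g * γ) = f g) : H ⧸ Δ → Z :=
  Quotient.lift (s := QuotientGroup.leftRel Δ) f (by
    intro a b hab
    have hab' : a⁻¹ * b ∈ Δ := QuotientGroup.leftRel_apply.mp hab
    simpa using (hf a (a⁻¹ * b) hab').symm)

/-- `descend` on a representative. [folklore] -/
@[simp] theorem descend_mk (f : H → Z) (hf : ∀ (g : H), ∀ γ ∈ Δ, f (g * γ) = f g) (g : H) :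
    descend Δ f hf (QuotientGroup.mk g) = f g := rfl

/-- `descend Δ f hf ∘ mk = f`. [folklore] -/
theorem descend_comp_mk (f : H → Z) (hf : ∀ (g : H), ∀ γ ∈ Δ, f (g * γ) = f g) :
    descend Δ f hf ∘ QuotientGroup.mk = f := rfl

end Descend

section Proj

variable (SX : Type*) [TopologicalSpace SX] {GU : Type*} [Group GU] [TopologicalSpace GU]
  (ΓU : Subgroup GU) {G : Type*} [Group G] [TopologicalSpace G] (Γ : Subgroup G)

/-- The projection `SX × (GU × G) → SX × ((GU ⧸ ΓU) × (G ⧸ Γ))` is an open quotient map. [folklore] -/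
theorem isOpenQuotientMap_id_prodMap_mk [SeparatelyContinuousMul GU] [SeparatelyContinuousMul G] :
    IsOpenQuotientMap (Prod.map (id : SX → SX)
      (Prod.map (QuotientGroup.mk : GU → GU ⧸ ΓU) (QuotientGroup.mk : G → G ⧸ Γ))) :=
  IsOpenQuotientMap.id.prodMap
    (QuotientGroup.isOpenQuotientMap_mk.prodMap QuotientGroup.isOpenQuotientMap_mk)

end Proj

namespace ThetaKernelDatum

variable {Mp : Type u} {SX : Type v} [TopologicalSpace Mp] [Group Mp] [TopologicalSpace SX]
variable {GU : Type*} [Group GU] [TopologicalSpace GU] {ΓU : Subgroup GU}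
variable {G : Type*} [Group G] [TopologicalSpace G] {Γ : Subgroup G}
variable (M : ThetaKernelDatum Mp SX GU ΓU G Γ)

/-- The descended kernel as a bare function on `(GU ⧸ ΓU) × (G ⧸ Γ)`.
[cite: FleigEtAl2018, §12.3 (12.37)–(12.38)] -/
def thetaQuot (Φ : SX) : (GU ⧸ ΓU) × (G ⧸ Γ) → ℂ := fun q =>
  descend ΓU
    (fun x => descend Γ (fun y => M.thetaFun Φ (x, y)) (fun y γ hγ => M.thetaFun_mul_right_W Φ x y hγ) q.2)
    (by
      intro x γU hγU
      induction q.2 using QuotientGroup.induction_on with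
      | H y => simp only [descend_mk, M.thetaFun_mul_right_U Φ x y hγU])
    q.1

/-- The descended kernel on representatives. [folklore] -/
@[simp] theorem thetaQuot_mk (Φ : SX) (x : GU) (y : G) :
    M.thetaQuot Φ (QuotientGroup.mk x, QuotientGroup.mk y) = M.thetaFun Φ (x, y) := rfl

/-- **Joint continuity downstairs**: `(Φ, ξ, q) ↦ θ_Φ(ξ, q)` is continuous on
`S(X_A) × ((GU ⧸ ΓU) × (G ⧸ Γ))`. [folklore] -/
theorem continuous_thetaQuot_uncurry [IsTopologicalGroup GU] [IsTopologicalGroup G] :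
    Continuous fun q : SX × ((GU ⧸ ΓU) × (G ⧸ Γ)) => M.thetaQuot q.1 q.2 := by
  rw [(isOpenQuotientMap_id_prodMap_mk SX ΓU Γ).isQuotientMap.continuous_iff]
  have heq : (fun q : SX × ((GU ⧸ ΓU) × (G ⧸ Γ)) => M.thetaQuot q.1 q.2) ∘
      Prod.map (id : SX → SX)
        (Prod.map (QuotientGroup.mk : GU → GU ⧸ ΓU) (QuotientGroup.mk : G → G ⧸ Γ)) =
      fun q : SX × (GU × G) => M.thetaFun q.1 q.2 := by
    funext q
    rfl
  rw [heq]
  exact M.continuous_thetaFun_uncurry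

/-- Continuity downstairs for fixed `Φ` (Théorème 6 only, not `dist_cont`). [folklore] -/
theorem continuous_thetaQuot [IsTopologicalGroup GU] [IsTopologicalGroup G] (Φ : SX) :
    Continuous (M.thetaQuot Φ) := by
  have hπ : IsOpenQuotientMap
      (Prod.map (QuotientGroup.mk : GU → GU ⧸ ΓU) (QuotientGroup.mk : G → G ⧸ Γ)) :=
    QuotientGroup.isOpenQuotientMap_mk.prodMap QuotientGroup.isOpenQuotientMap_mk
  rw [hπ.isQuotientMap.continuous_iff]
  have heq : M.thetaQuot Φ ∘
      Prod.map (QuotientGroup.mk : GU → GU ⧸ ΓU) (QuotientGroup.mk : G → G ⧸ Γ) = M.thetaFun Φ := by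
    funext p
    rfl
  rw [heq]
  exact M.continuous_thetaFun Φ

variable [IsTopologicalGroup GU] [IsTopologicalGroup G]

/-- **The theta kernels `θ_Φ ∈ C((GU ⧸ ΓU) × (G ⧸ Γ), ℂ)`, `Φ ∈ SK`** — constructed.
[cite: FleigEtAl2018, §12.3 (12.37)–(12.38)] -/
def θ (Φ : M.SK) : C((GU ⧸ ΓU) × (G ⧸ Γ), ℂ) :=
  ⟨M.thetaQuot Φ.1, M.continuous_thetaQuot Φ.1⟩

/-- Unfolding `θ`. [folklore] -/
theorem θ_apply (Φ : M.SK) (q : (GU ⧸ ΓU) × (G ⧸ Γ)) : M.θ Φ q = M.thetaQuot Φ.1 q := rfl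

/-- **The dictionary, on representatives**: `θ_Φ(xΓU, yΓ) = Θ_Φ(s(x, y)⁻¹)`. [folklore] -/
theorem θ_mk (Φ : M.SK) (x : GU) (y : G) :
    M.θ Φ (QuotientGroup.mk x, QuotientGroup.mk y) = M.W.theta Φ.1 (M.s (x, y)⁻¹) := rfl

/-- `θ_Φ(xΓU, yΓ) = Θ_{s(x, y)⁻¹Φ}(1)`. [folklore] -/
theorem θ_mk_eq_dist (Φ : M.SK) (x : GU) (y : G) :
    M.θ Φ (QuotientGroup.mk x, QuotientGroup.mk y) = M.W.theta (M.W.act (M.s (x, y)⁻¹) Φ.1) 1 :=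
  M.thetaFun_eq_dist Φ.1 (x, y)

/-! ## 5. The three structural laws -/

/-- **Structural law 2**: `Φ ↦ θ_Φ` is continuous from `SK` to `C((GU ⧸ ΓU) × (G ⧸ Γ), ℂ)` (compact-open
topology) — from n° 39 and the continuity of the theta distribution. [folklore] -/
theorem θ_cont : Continuous M.θ := by
  apply ContinuousMap.continuous_of_continuous_uncurry
  have h : Continuous fun q : M.SK × ((GU ⧸ ΓU) × (G ⧸ Γ)) => M.thetaQuot q.1.1 q.2 :=
    M.continuous_thetaQuot_uncurry.comp (continuous_subtype_val.prodMap continuous_id)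
  exact h

/-- **Structural law 3** (the translation law `θ_Φ(g, yh) = θ_{ω(h)Φ}(g, y)` in the coset convention):
`θ_{ω(h)Φ}(ξ, q) = θ_Φ(ξ, h⁻¹ • q)`. [folklore] -/
theorem θ_omg (h : G) (Φ : M.SK) (ξ : GU ⧸ ΓU) (q : G ⧸ Γ) :
    M.θ (M.omg h Φ) (ξ, q) = M.θ Φ (ξ, h⁻¹ • q) := by
  induction ξ using QuotientGroup.induction_on with
  | H x =>
    induction q using QuotientGroup.induction_on with
    | H y =>
      have hsm : h⁻¹ • (QuotientGroup.mk y : G ⧸ Γ) = QuotientGroup.mk (h⁻¹ * y) := by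
        rw [MulAction.Quotient.smul_mk, smul_eq_mul]
      rw [hsm, θ_mk, θ_mk, coe_omg, M.theta_act, ← map_mul]
      congr 2
      ext <;> simp

/-- **The three structural laws** of the triple `(SK, omg, θ)`, bundled. [folklore] -/
theorem structural_laws :
    (∀ Φ : M.SK, M.omg 1 Φ = Φ) ∧ Continuous M.θ ∧
      ∀ (h : G) (Φ : M.SK) (ξ : GU ⧸ ΓU) (q : G ⧸ Γ), M.θ (M.omg h Φ) (ξ, q) = M.θ Φ (ξ, h⁻¹ • q) :=
  ⟨M.omg_one, M.θ_cont, M.θ_omg⟩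

/-! ## 6. Two by-products -/

/-- `θ_{ω(h)Φ}` is the translate of `θ_Φ`, as an identity of functions of the second variable.
[folklore] -/
theorem θ_omg_curry (h : G) (Φ : M.SK) (ξ : GU ⧸ ΓU) :
    (fun q => M.θ (M.omg h Φ) (ξ, q)) = fun q => M.θ Φ (ξ, h⁻¹ • q) :=
  funext fun q => M.θ_omg h Φ ξ q

/-- Joint continuity of `(h, ξ, q) ↦ θ_{ω(h)Φ}(ξ, q)` on `G × (GU ⧸ ΓU) × (G ⧸ Γ)`: from `θ_omg` and the
continuity of the action of `G` on `G ⧸ Γ`. [folklore] -/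
theorem continuous_θ_omg_uncurry (Φ : M.SK) :
    Continuous fun q : G × ((GU ⧸ ΓU) × (G ⧸ Γ)) => M.θ (M.omg q.1 Φ) (q.2.1, q.2.2) := by
  have heq : (fun q : G × ((GU ⧸ ΓU) × (G ⧸ Γ)) => M.θ (M.omg q.1 Φ) (q.2.1, q.2.2)) =
      fun q => M.θ Φ (q.2.1, q.1⁻¹ • q.2.2) := by
    funext q
    exact M.θ_omg q.1 Φ q.2.1 q.2.2
  rw [heq]
  refine (M.θ Φ).continuous.comp ?_
  exact continuous_snd.fst.prodMk ((continuous_fst.inv).smul continuous_snd.snd)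

end ThetaKernelDatum

end Literature.NumberTheory.Weil1964

end
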